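import Literature.NumberTheory.Automorphic.GodementJacquetLocalConvergenceProofs
import Literature.NumberTheory.Automorphic.HeckeAlgebra
import Literature.NumberTheory.Automorphic.RankinSelbergLocalInvariance
import Mathlib.LinearAlgebra.Matrix.Adjugate
import HarnessLib

/-!
# The Hecke shift of the local Godement–Jacquet zeta integrals and the Cayley–Hamilton step

Topic `NumberTheory/Automorphic`; theorems only (no definition, no named fact). First of the
support files of the discharge of `GodementJacquet1972_local_existsUnique_hasGJLFactor`
(`GodementJacquetLocal`; Godement–Jacquet, LNM 260 (1972), Thm. 3.3 (2): the zeta integrals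
`Z(Φ, s, f) = ∫ Φ(x) f(x) |det x|^s dμ(x)` of an irreducible admissible representation of
`GL_n(F)` are rational in `q^{-s}` with a common denominator). Setting: `F` a non-archimedean
local field, `ρ` a representation of `GL_n(F)` on a complex vector space `V`, `ψ` a linear form,
`μ` a right-invariant measure on `GL_n(F)`, `K ≤ GL_n(𝒪_F)` a subgroup, `w ∈ V^K`.

* `gjLocalZeta_matrixCoeff_apply` (**translating the vector**): for `ζ ∈ GL_n(F)`,
  `Z(Φ, s, ⟨ρ(·) ρ(ζ) u, ψ⟩) = |det ζ⁻¹|^s · Z(Φ(· ζ⁻¹), s, ⟨ρ(·) u, ψ⟩)` (the substitution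
  `x ↦ x ζ⁻¹`).
* `gjLocalZeta_translate_left_mem` (**`K`-invariance of the shifts**): for `k ∈ K` and
  `w ∈ V^K`, `Z(Φ(· k g), s, ⟨ρ(·) w, ψ⟩) = Z(Φ(· g), s, ⟨ρ(·) w, ψ⟩)`.
* `card_mul_gjLocalZeta_heckeOperator` (**the Hecke shift**): for the coset-sum Hecke operator
  `[K t K] = heckeOperator ρ K t` (`HeckeAlgebra`), `Φ` right-`K`-invariant and any finite family
  `𝒰 ⊆ K`,
  `#𝒰 · Z(Φ, s, ⟨ρ(·) [KtK] w, ψ⟩) =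
     #(KtK/K) · |det t⁻¹|^s · Z(∑_{γ ∈ 𝒰} Φ(· γ t⁻¹), s, ⟨ρ(·) w, ψ⟩)`: every coset `yK ⊆ KtK`
  contributes `|det t⁻¹|^s Z(Φ(· t⁻¹), s, ⟨ρ(·) w, ψ⟩)`, and so does every `γ ∈ 𝒰` on the
  right. This is the identity `Z(Φ, f ⋆ 𝟙_{KtK}) = Z(Φ ⋆ 𝟙_{Kt⁻¹K}, f)`
  of the printed theory (Godement–Jacquet (1972), §3; Jacquet (1979), §1) in a form free of
  convolution algebras; it moves the action of the Hecke algebra from the coefficient to the test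
  function.
* `det_mul_eq_sum_mul_adjugate_of_sub` (**the Cayley–Hamilton step**): if a row vector `z`
  satisfies `y = z - c · z A`, then `det(1 - c A) z = y · adj(1 - c A)`; with
  `eval_det_one_sub_X_pow_smul`, `eval_adjugate_one_sub_X_pow_smul`,
  `eval_zero_det_one_sub_X_pow_smul` the determinant and the adjugate are the values at
  `T = q^{-s}` of polynomials in `T`, the determinant having constant term `1`. Applied to the
  row vector `z_i = Z(Φ, s, ⟨ρ(·) b_i, ψ⟩)` over a basis `b` of `V^K` and the matrix `A` of
  `[KtK]` on `V^K`, this bounds the denominator of the `Z(Φ, s, ·)` by `det(1 - q^{-ds} A)` times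
  that of the shifted test function `Φ - ∑_γ Φ(· γ t⁻¹)` — the engine of the rationality proof.

## References

* R. Godement, H. Jacquet, *Zeta functions of simple algebras*, LNM 260 (1972), §3, Thm. 3.3
  [GodementJacquet1972] (not held; statement as recorded in `GodementJacquetLocal`).
* H. Jacquet, *Principal `L`-functions of the linear group*, Proc. Sympos. Pure Math. 33 (1979),
  Part 2, §1, Prop. (1.2) [JacquetCorvallis1979].
-/

set_option autoImplicit false

noncomputable section

open scoped MatrixGroups Matrix NNReal
open Matrix ValuativeRel

namespace Literature.NumberTheory.Automorphic

/-! ### Substitutions in the zeta integral -/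

section Shift

open _root_.MeasureTheory Literature.NumberTheory.GaloisRepresentations.IsNonarchimedeanLocalField

variable {F : Type*} [Field F] [ValuativeRel F] [TopologicalSpace F] [IsNonarchimedeanLocalField F]
  {n : ℕ} [MeasurableSpace (GL (Fin n) F)] [BorelSpace (GL (Fin n) F)]
  {V : Type*} [AddCommGroup V] [Module ℂ V] (ρ : Representation ℂ (GL (Fin n) F) V)
  (μ : Measure (GL (Fin n) F))

omit [MeasurableSpace (GL (Fin n) F)] [BorelSpace (GL (Fin n) F)] in
/-- `|det (x y)|^s = |det x|^s |det y|^s` (complex powers of non-negative reals;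
`normAbs_det_mul` of `RankinSelbergLocalInvariance`). [folklore] -/
theorem cpow_normAbs_det_mul (x y : GL (Fin n) F) (s : ℂ) :
    (((normAbs F ((Matrix.GeneralLinearGroup.det (x * y) : Fˣ) : F) : ℝ≥0) : ℝ) : ℂ) ^ s =
      (((normAbs F ((Matrix.GeneralLinearGroup.det x : Fˣ) : F) : ℝ≥0) : ℝ) : ℂ) ^ s *
        (((normAbs F ((Matrix.GeneralLinearGroup.det y : Fˣ) : F) : ℝ≥0) : ℝ) : ℂ) ^ s := by
  rw [normAbs_det_mul, Complex.ofReal_mul,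
    Complex.mul_cpow_ofReal_nonneg (NNReal.coe_nonneg _) (NNReal.coe_nonneg _)]

omit [MeasurableSpace (GL (Fin n) F)] [BorelSpace (GL (Fin n) F)] in
/-- `|det k|^s = 1` for `k ∈ GL_n(𝒪_F)`. [folklore] -/
theorem cpow_normAbs_det_of_mem_glInt {k : GL (Fin n) F} (hk : k ∈ glInt n F) (s : ℂ) :
    (((normAbs F ((Matrix.GeneralLinearGroup.det k : Fˣ) : F) : ℝ≥0) : ℝ) : ℂ) ^ s = 1 := by
  rw [normAbs_det_eq_one_of_mem_glInt hk, NNReal.coe_one, Complex.ofReal_one, Complex.one_cpow]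

/-- **Translating the vector of a coefficient.** For `ζ ∈ GL_n(F)` and a right-invariant
measure, `Z(Φ, s, ⟨ρ(·) ρ(ζ) u, ψ⟩) = |det ζ⁻¹|^s · Z(Φ(· ζ⁻¹), s, ⟨ρ(·) u, ψ⟩)`: substitute
`x ↦ x ζ⁻¹` in `∫ Φ(x) ψ(ρ(x ζ) u) |det x|^s dμ(x)` (valid for the Bochner integral with no
integrability hypothesis). [folklore] -/
theorem gjLocalZeta_matrixCoeff_apply [μ.IsMulRightInvariant] (Φ : Matrix (Fin n) (Fin n) F → ℂ)
    (ψ : Module.Dual ℂ V) (u : V) (ζ : GL (Fin n) F) (s : ℂ) :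
    gjLocalZeta μ Φ (ρ.matrixCoeff ψ (ρ ζ u)) s =
      (((normAbs F ((Matrix.GeneralLinearGroup.det ζ⁻¹ : Fˣ) : F) : ℝ≥0) : ℝ) : ℂ) ^ s *
        gjLocalZeta μ (fun X => Φ (X * ((ζ⁻¹ : GL (Fin n) F) : Matrix (Fin n) (Fin n) F)))
          (ρ.matrixCoeff ψ u) s := by
  unfold gjLocalZeta
  rw [← integral_const_mul]
  conv_lhs => rw [← integral_mul_right_eq_self _ ζ⁻¹]
  refine integral_congr_ae (Filter.Eventually.of_forall fun x => ?_)
  have h2 : ρ (x * ζ⁻¹) (ρ ζ u) = ρ x u := by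
    rw [← Module.End.mul_apply, ← map_mul, inv_mul_cancel_right]
  simp only [gjLocalIntegrand, Representation.matrixCoeff_apply, h2]
  rw [cpow_normAbs_det_mul x ζ⁻¹ s, Units.val_mul]
  ring

variable {K : Subgroup (GL (Fin n) F)}

/-- **Left `K`-invariance of the shifted zeta integrals.** For `k ∈ K ≤ GL_n(𝒪_F)`, `w ∈ V^K`
and a right-invariant measure, `Z(Φ(· k g), s, ⟨ρ(·) w, ψ⟩) = Z(Φ(· g), s, ⟨ρ(·) w, ψ⟩)`:
substitute `x ↦ x k⁻¹` and use `ρ(k⁻¹) w = w`, `|det k| = 1`. [folklore] -/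
theorem gjLocalZeta_translate_left_mem [μ.IsMulRightInvariant] (hK : K ≤ glInt n F)
    (Φ : Matrix (Fin n) (Fin n) F → ℂ) (ψ : Module.Dual ℂ V) {w : V} (hw : w ∈ ρ.fixedPoints K)
    {k : GL (Fin n) F} (hk : k ∈ K) (g : GL (Fin n) F) (s : ℂ) :
    gjLocalZeta μ (fun X => Φ (X * ((k * g : GL (Fin n) F) : Matrix (Fin n) (Fin n) F)))
        (ρ.matrixCoeff ψ w) s =
      gjLocalZeta μ (fun X => Φ (X * (g : Matrix (Fin n) (Fin n) F))) (ρ.matrixCoeff ψ w) s := by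
  unfold gjLocalZeta
  conv_lhs => rw [← integral_mul_right_eq_self _ k⁻¹]
  refine integral_congr_ae (Filter.Eventually.of_forall fun x => ?_)
  have hkw : ρ k⁻¹ w = w := (ρ.mem_fixedPoints K w).1 hw _ (K.inv_mem hk)
  have e : (((x * k⁻¹ : GL (Fin n) F) : Matrix (Fin n) (Fin n) F)) *
      ((k * g : GL (Fin n) F) : Matrix (Fin n) (Fin n) F) =
      (x : Matrix (Fin n) (Fin n) F) * (g : Matrix (Fin n) (Fin n) F) := by
    rw [← Units.val_mul, ← Units.val_mul, show x * k⁻¹ * (k * g) = x * g by group]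
  simp only [gjLocalIntegrand, Representation.matrixCoeff_apply, e, map_mul ρ, Module.End.mul_apply,
    hkw]
  rw [cpow_normAbs_det_mul x k⁻¹ s, cpow_normAbs_det_of_mem_glInt (hK (K.inv_mem hk)), mul_one]

omit [TopologicalSpace F] [IsNonarchimedeanLocalField F] [BorelSpace (GL (Fin n) F)] in
/-- **Right `K`-invariance of the shifted test functions.** If `Φ(X k) = Φ(X)` for `k ∈ K`, then
`Φ(· g k) = Φ(· g)`, hence the zeta integrals agree. [folklore] -/
theorem gjLocalZeta_translate_right_mem [TopologicalSpace F] [IsNonarchimedeanLocalField F]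
    {Φ : Matrix (Fin n) (Fin n) F → ℂ}
    (hΦ : ∀ X : Matrix (Fin n) (Fin n) F, ∀ k ∈ K, Φ (X * (k : Matrix (Fin n) (Fin n) F)) = Φ X)
    (f : GL (Fin n) F → ℂ) {k : GL (Fin n) F} (hk : k ∈ K) (g : GL (Fin n) F) (s : ℂ) :
    gjLocalZeta μ (fun X => Φ (X * ((g * k : GL (Fin n) F) : Matrix (Fin n) (Fin n) F))) f s =
      gjLocalZeta μ (fun X => Φ (X * (g : Matrix (Fin n) (Fin n) F))) f s := by
  unfold gjLocalZeta
  refine integral_congr_ae (Filter.Eventually.of_forall fun x => ?_)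
  simp only [gjLocalIntegrand]
  rw [Units.val_mul, ← Matrix.mul_assoc, hΦ _ k hk]

omit [TopologicalSpace F] [IsNonarchimedeanLocalField F] [MeasurableSpace (GL (Fin n) F)]
  [BorelSpace (GL (Fin n) F)] [ValuativeRel F] [Field F] in
/-- Representatives of the cosets in `KtK`: for `y` in the `K`-orbit of `tK` in `G ⧸ K`,
`y.out = k₁ t k₂` with `k₁, k₂ ∈ K`. [folklore] -/
theorem exists_out_eq_mul_mul_of_mem_orbit {G : Type*} [Group G] {L : Subgroup G} {t : G}
    {y : G ⧸ L} (hy : y ∈ MulAction.orbit L (t : G ⧸ L)) :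
    ∃ k₁ ∈ L, ∃ k₂ ∈ L, y.out = k₁ * t * k₂ := by
  obtain ⟨k, rfl⟩ := hy
  obtain ⟨k₂, hk₂⟩ := QuotientGroup.mk_out_eq_mul L ((k : G) * t)
  refine ⟨k, k.2, k₂, k₂.2, ?_⟩
  rw [← hk₂]
  rfl

omit [BorelSpace (GL (Fin n) F)] in
/-- The zeta integral `Z(Φ, s, ⟨ρ(·) u, ψ⟩)` is additive in the vector `u` (given absolute
convergence of each term). [folklore] -/
theorem gjLocalZeta_matrixCoeff_sum {ι : Type*} (T : Finset ι) (Φ : Matrix (Fin n) (Fin n) F → ℂ)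
    (ψ : Module.Dual ℂ V) (u : ι → V) (s : ℂ)
    (hint : ∀ i ∈ T, Integrable (gjLocalIntegrand Φ (ρ.matrixCoeff ψ (u i)) s) μ) :
    gjLocalZeta μ Φ (ρ.matrixCoeff ψ (∑ i ∈ T, u i)) s =
      ∑ i ∈ T, gjLocalZeta μ Φ (ρ.matrixCoeff ψ (u i)) s := by
  unfold gjLocalZeta
  rw [← integral_finsetSum _ hint]
  refine integral_congr_ae (Filter.Eventually.of_forall fun x => ?_)
  simp only [gjLocalIntegrand, Representation.matrixCoeff_apply, map_sum, Finset.mul_sum,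
    Finset.sum_mul]

omit [BorelSpace (GL (Fin n) F)] in
/-- The zeta integral `Z(Φ, s, f)` is additive in the test function `Φ` (given absolute
convergence of each term). [folklore] -/
theorem gjLocalZeta_sum_left {ι : Type*} (T : Finset ι) (Φ : ι → Matrix (Fin n) (Fin n) F → ℂ)
    (f : GL (Fin n) F → ℂ) (s : ℂ) (hint : ∀ i ∈ T, Integrable (gjLocalIntegrand (Φ i) f s) μ) :
    gjLocalZeta μ (fun X => ∑ i ∈ T, Φ i X) f s = ∑ i ∈ T, gjLocalZeta μ (Φ i) f s := by
  unfold gjLocalZeta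
  rw [← integral_finsetSum _ hint]
  refine integral_congr_ae (Filter.Eventually.of_forall fun x => ?_)
  simp only [gjLocalIntegrand, Finset.sum_mul]

omit [MeasurableSpace (GL (Fin n) F)] [BorelSpace (GL (Fin n) F)] in
/-- The shifted integrand `x ↦ Φ(x γ g) ⟨ρ(x) w, ψ⟩ |det x|^s` is the translate by `γ ∈ K` of
`x ↦ Φ(x g) ⟨ρ(x) w, ψ⟩ |det x|^s` when `w ∈ V^K`, `K ≤ GL_n(𝒪_F)`. [folklore] -/
theorem gjLocalIntegrand_translate_mem (hK : K ≤ glInt n F) (Φ : Matrix (Fin n) (Fin n) F → ℂ)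
    (ψ : Module.Dual ℂ V) {w : V} (hw : w ∈ ρ.fixedPoints K) {γ : GL (Fin n) F} (hγ : γ ∈ K)
    (g : GL (Fin n) F) (s : ℂ) :
    gjLocalIntegrand (fun X => Φ (X * ((γ * g : GL (Fin n) F) : Matrix (Fin n) (Fin n) F)))
        (ρ.matrixCoeff ψ w) s =
      fun x => gjLocalIntegrand (fun X => Φ (X * (g : Matrix (Fin n) (Fin n) F)))
        (ρ.matrixCoeff ψ w) s (x * γ) := by
  funext x
  have hγw : ρ γ w = w := (ρ.mem_fixedPoints K w).1 hw _ hγ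
  have e : ((x * γ : GL (Fin n) F) : Matrix (Fin n) (Fin n) F) * (g : Matrix (Fin n) (Fin n) F) =
      (x : Matrix (Fin n) (Fin n) F) * ((γ * g : GL (Fin n) F) : Matrix (Fin n) (Fin n) F) := by
    rw [← Units.val_mul, ← Units.val_mul, mul_assoc]
  rw [gjLocalIntegrand, gjLocalIntegrand, Representation.matrixCoeff_apply,
    Representation.matrixCoeff_apply, e, map_mul, Module.End.mul_apply, hγw,
    cpow_normAbs_det_mul x γ s, cpow_normAbs_det_of_mem_glInt (hK hγ), mul_one]

/-- **The Hecke shift of the zeta integrals.** Let `K ≤ GL_n(𝒪_F)`, `μ` right invariant,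
`w ∈ V^K`, `Φ` right-`K`-invariant, `t ∈ GL_n(F)` with `KtK/K` finite, and `𝒰 ⊆ K` any finite
family. If all coefficients `⟨ρ(·) u, ψ⟩` are `Z(Φ, s, ·)`-integrable and
`Z(Φ(· t⁻¹), s, ⟨ρ(·) w, ψ⟩)` converges absolutely, then
`#𝒰 · Z(Φ, s, ⟨ρ(·) [KtK] w, ψ⟩) = #(KtK/K) · |det t⁻¹|^s · Z(∑_{γ ∈ 𝒰} Φ(· γ t⁻¹), s, ⟨ρ(·) w, ψ⟩)`
for the coset-sum Hecke operator `[KtK] w = ∑_{yK ⊆ KtK} ρ(y) w`: by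
`gjLocalZeta_matrixCoeff_apply` each coset `yK = k₁ t k₂ K` contributes
`|det t⁻¹|^s Z(Φ(· k₂⁻¹ t⁻¹ k₁⁻¹), s, ⟨ρ(·) w, ψ⟩) = |det t⁻¹|^s Z(Φ(· t⁻¹), s, ⟨ρ(·) w, ψ⟩)`
(`gjLocalZeta_translate_right_mem`, `gjLocalZeta_translate_left_mem`), and each `γ ∈ 𝒰`
contributes `Z(Φ(· γ t⁻¹), s, ⟨ρ(·) w, ψ⟩) = Z(Φ(· t⁻¹), s, ⟨ρ(·) w, ψ⟩)`. (The identity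
`Z(Φ, f ⋆ 𝟙_{KtK}) = Z(Φ ⋆ 𝟙_{Kt⁻¹K}, f)` behind Godement–Jacquet (1972), §3 and Jacquet (1979),
§1, Prop. (1.2).) [folklore] -/
theorem card_mul_gjLocalZeta_heckeOperator [μ.IsMulRightInvariant] (hK : K ≤ glInt n F)
    {Φ : Matrix (Fin n) (Fin n) F → ℂ}
    (hΦ : ∀ X : Matrix (Fin n) (Fin n) F, ∀ k ∈ K, Φ (X * (k : Matrix (Fin n) (Fin n) F)) = Φ X)
    (ψ : Module.Dual ℂ V) {w : V} (hw : w ∈ ρ.fixedPoints K) {t : GL (Fin n) F}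
    (hfin : (MulAction.orbit K (t : GL (Fin n) F ⧸ K)).Finite) (𝒰 : Finset (GL (Fin n) F))
    (h𝒰 : ∀ γ ∈ 𝒰, γ ∈ K) (s : ℂ)
    (hint₁ : ∀ u : V, Integrable (gjLocalIntegrand Φ (ρ.matrixCoeff ψ u) s) μ)
    (hint₂ : Integrable (gjLocalIntegrand
      (fun X => Φ (X * ((t⁻¹ : GL (Fin n) F) : Matrix (Fin n) (Fin n) F)))
      (ρ.matrixCoeff ψ w) s) μ) :
    (𝒰.card : ℂ) * gjLocalZeta μ Φ (ρ.matrixCoeff ψ (heckeOperator ρ K t w)) s =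
      (hfin.toFinset.card : ℂ) *
        (((normAbs F ((Matrix.GeneralLinearGroup.det t⁻¹ : Fˣ) : F) : ℝ≥0) : ℝ) : ℂ) ^ s *
        gjLocalZeta μ
          (fun X => ∑ γ ∈ 𝒰, Φ (X * ((γ * t⁻¹ : GL (Fin n) F) : Matrix (Fin n) (Fin n) F)))
          (ρ.matrixCoeff ψ w) s := by
  classical
  -- the common value of all the shifted zeta integrals
  set Z₀ : ℂ := gjLocalZeta μ (fun X => Φ (X * ((t⁻¹ : GL (Fin n) F) : Matrix (Fin n) (Fin n) F)))
    (ρ.matrixCoeff ψ w) s with hZ₀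
  -- left-hand side: unfold the Hecke operator over the finite orbit
  have hT : heckeOperator ρ K t w = ∑ y ∈ hfin.toFinset, ρ y.out w := by
    rw [heckeOperator, finsum_mem_eq_finite_toFinset_sum _ hfin, LinearMap.sum_apply]
  have hL : gjLocalZeta μ Φ (ρ.matrixCoeff ψ (heckeOperator ρ K t w)) s =
      hfin.toFinset.card *
        ((((normAbs F ((Matrix.GeneralLinearGroup.det t⁻¹ : Fˣ) : F) : ℝ≥0) : ℝ) : ℂ) ^ s *
          Z₀) := by
    rw [hT, gjLocalZeta_matrixCoeff_sum ρ μ _ Φ ψ _ s (fun y _ => hint₁ _), ← nsmul_eq_mul,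
      ← Finset.sum_const]
    refine Finset.sum_congr rfl fun y hy => ?_
    rw [Set.Finite.mem_toFinset] at hy
    obtain ⟨k₁, hk₁, k₂, hk₂, hout⟩ := exists_out_eq_mul_mul_of_mem_orbit hy
    rw [gjLocalZeta_matrixCoeff_apply, hout]
    have e1 : (k₁ * t * k₂)⁻¹ = k₂⁻¹ * t⁻¹ * k₁⁻¹ := by group
    have hdet :
        (((normAbs F ((Matrix.GeneralLinearGroup.det (k₁ * t * k₂)⁻¹ : Fˣ) : F) : ℝ≥0) : ℝ) :
          ℂ) ^ s =
        (((normAbs F ((Matrix.GeneralLinearGroup.det t⁻¹ : Fˣ) : F) : ℝ≥0) : ℝ) : ℂ) ^ s := by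
      rw [e1, cpow_normAbs_det_mul, cpow_normAbs_det_mul,
        cpow_normAbs_det_of_mem_glInt (hK (K.inv_mem hk₁)),
        cpow_normAbs_det_of_mem_glInt (hK (K.inv_mem hk₂)), one_mul, mul_one]
    rw [hdet, e1, gjLocalZeta_translate_right_mem μ hΦ _ (K.inv_mem hk₁),
      gjLocalZeta_translate_left_mem ρ μ hK Φ ψ hw (K.inv_mem hk₂)]
  -- right-hand side: each `γ ∈ 𝒰` contributes `Z₀`
  have hint₃ : ∀ γ ∈ 𝒰, Integrable (gjLocalIntegrand
      (fun X => Φ (X * ((γ * t⁻¹ : GL (Fin n) F) : Matrix (Fin n) (Fin n) F)))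
      (ρ.matrixCoeff ψ w) s) μ := by
    intro γ hγ
    rw [gjLocalIntegrand_translate_mem ρ hK Φ ψ hw (h𝒰 γ hγ)]
    exact hint₂.comp_mul_right γ
  have hR : gjLocalZeta μ
      (fun X => ∑ γ ∈ 𝒰, Φ (X * ((γ * t⁻¹ : GL (Fin n) F) : Matrix (Fin n) (Fin n) F)))
      (ρ.matrixCoeff ψ w) s = 𝒰.card * Z₀ := by
    rw [gjLocalZeta_sum_left μ 𝒰
      (fun γ X => Φ (X * ((γ * t⁻¹ : GL (Fin n) F) : Matrix (Fin n) (Fin n) F))) _ s hint₃,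
      ← nsmul_eq_mul, ← Finset.sum_const]
    refine Finset.sum_congr rfl fun γ hγ => ?_
    exact gjLocalZeta_translate_left_mem ρ μ hK Φ ψ hw (h𝒰 γ hγ) t⁻¹ s
  rw [hL, hR]
  ring

end Shift

/-! ### The Cayley–Hamilton step -/

section CayleyHamilton

open Polynomial

variable {ι : Type*} [Fintype ι] [DecidableEq ι]

/-- **Row vectors and the adjugate.** If `y = z - c · (z A)` (row vectors), then
`det(1 - c A) · z_i = ∑_k y_k adj(1 - c A)_{k i}`: `y = z (1 - c A)` and
`(1 - c A) adj(1 - c A) = det(1 - c A)`. [folklore] -/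
theorem det_mul_eq_sum_mul_adjugate_of_sub {R : Type*} [CommRing R] (A : Matrix ι ι R) (c : R)
    (z y : ι → R) (h : ∀ i, y i = z i - c * ∑ k, z k * A k i) (i : ι) :
    (1 - c • A).det * z i = ∑ k, y k * (1 - c • A).adjugate k i := by
  have hy : y = z ᵥ* (1 - c • A) := by
    funext j
    rw [h j, Matrix.vecMul, dotProduct]
    simp only [Matrix.sub_apply, Matrix.one_apply, Matrix.smul_apply, smul_eq_mul, mul_sub,
      Finset.sum_sub_distrib, mul_ite, mul_one, mul_zero, Finset.sum_ite_eq', Finset.mem_univ,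
      if_true, Finset.mul_sum]
    congr 1
    refine Finset.sum_congr rfl fun k _ => ?_
    ring
  have key : y ᵥ* (1 - c • A).adjugate = (1 - c • A).det • z := by
    rw [hy, Matrix.vecMul_vecMul, Matrix.mul_adjugate, Matrix.vecMul_smul, Matrix.vecMul_one]
  have := congrFun key i
  rw [Pi.smul_apply, smul_eq_mul] at this
  rw [← this, Matrix.vecMul, dotProduct]

omit [Fintype ι] in
/-- The matrix `1 - T^d A` over `ℂ[T]` specialises at `T = x` to `1 - x^d A`. [folklore] -/
theorem map_eval_one_sub_X_pow_smul (A : Matrix ι ι ℂ) (d : ℕ) (x : ℂ) :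
    (1 - (X ^ d : ℂ[X]) • A.map Polynomial.C).map (Polynomial.eval x) = 1 - x ^ d • A := by
  ext i j
  simp only [Matrix.map_apply, Matrix.sub_apply, Matrix.one_apply, Matrix.smul_apply, smul_eq_mul,
    Polynomial.eval_sub, Polynomial.eval_mul, Polynomial.eval_pow, Polynomial.eval_X,
    Polynomial.eval_C, apply_ite (Polynomial.eval x), Polynomial.eval_one, Polynomial.eval_zero]

/-- `det(1 - x^d A)` is the value at `x` of the polynomial `det(1 - T^d A) ∈ ℂ[T]`. [folklore] -/
theorem eval_det_one_sub_X_pow_smul (A : Matrix ι ι ℂ) (d : ℕ) (x : ℂ) :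
    ((1 - (X ^ d : ℂ[X]) • A.map Polynomial.C).det).eval x = (1 - x ^ d • A).det := by
  rw [← Polynomial.coe_evalRingHom, RingHom.map_det, RingHom.mapMatrix_apply,
    Polynomial.coe_evalRingHom, map_eval_one_sub_X_pow_smul]

/-- The entries of `adj(1 - x^d A)` are the values at `x` of the entries of the polynomial matrix
`adj(1 - T^d A)`. [folklore] -/
theorem eval_adjugate_one_sub_X_pow_smul (A : Matrix ι ι ℂ) (d : ℕ) (x : ℂ) (k i : ι) :
    ((1 - (X ^ d : ℂ[X]) • A.map Polynomial.C).adjugate k i).eval x =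
      (1 - x ^ d • A).adjugate k i := by
  have h := RingHom.map_adjugate (Polynomial.evalRingHom x)
    (1 - (X ^ d : ℂ[X]) • A.map Polynomial.C)
  rw [RingHom.mapMatrix_apply, RingHom.mapMatrix_apply, Polynomial.coe_evalRingHom,
    map_eval_one_sub_X_pow_smul] at h
  have := congrFun (congrFun h k) i
  rw [Matrix.map_apply] at this
  exact this

/-- For `d ≥ 1` the polynomial `det(1 - T^d A)` has constant term `1`. [folklore] -/
theorem eval_zero_det_one_sub_X_pow_smul (A : Matrix ι ι ℂ) {d : ℕ} (hd : d ≠ 0) :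
    ((1 - (X ^ d : ℂ[X]) • A.map Polynomial.C).det).eval 0 = 1 := by
  rw [eval_det_one_sub_X_pow_smul, zero_pow hd, zero_smul, sub_zero, Matrix.det_one]

end CayleyHamilton

end Literature.NumberTheory.Automorphic
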